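import Literature.NumberTheory.Automorphic.TwistedQuotientScaledLattices
import Literature.NumberTheory.Automorphic.TwistedQuotientIntFunNaturality
import Literature.NumberTheory.Automorphic.IntegralEigenclassHeckePoint
import Literature.NumberTheory.Automorphic.TwistedQuotientIndFunShapiroNatural
import Literature.NumberTheory.Automorphic.TwistedQuotientIndFunDirectedInjective
import Literature.Algebra.Homology.GroupCohomologyFiniteTypeResolution
import Literature.Algebra.Module.PPowerTorsionEigenclass
import Mathlib.LinearAlgebra.FreeModule.PID
import Mathlib.LinearAlgebra.Dimension.Free
import HarnessLib

/-!
# A rational Hecke eigenclass is the image of an exact integral eigenclass of bounded content on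
# some finitely generated free lattice

Topic `NumberTheory/Automorphic`; namespace `Literature.NumberTheory.Automorphic.TwistedQuotient`.
Theorems only; no definition, no named fact, no instance, no `sorry`.

Let `k` be a Noetherian local principal ideal domain with `p ∈ 𝔪_k` (e.g. `𝒪_E`), `k → K` (e.g.
`ℚ̄_p`), `π` a `K`-linear representation of `𝒢` on `V`, `M ⊆ V` a finitely generated `L`-stable
`k`-lattice spanning `V` over `K`, and suppose the `Γ`-orbits on `𝒢 ⧸ L` have finitely many
representatives with stabilisers of type `FP_∞` over `k`.  Let `ξ ∈ H^q_k(S_L, Ṽ)` be a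
simultaneous eigenclass of Hecke operators `[L δ_j L]` (`π(δ_j) = 1`) with eigenvalues `χ_j ∈ k`,
not killed by any power of `p`.  Then (`exists_intFun_exact_eigenclass`) there are a finitely
generated FREE `L`-stable lattice `M' = M_s ⊇ M` (a scaled lattice, `TwistedQuotientScaledLattices`),
an EXACT eigenclass `c ∈ H^q(Γ, M̃')` of the integral Hecke operators with the same eigenvalues,
of bounded content (`p^u c ≠ p^{u+m₀} y`), mapping to `ξ`; and `M'` inherits the congruences of `M`.

Steps: `ξ` comes from some `H^q(Γ, M̃_s)` (`exists_intFun_map_eq`: directed union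
`V = ⋃_s M_s`, [Brown1982CohomologyGroups, VIII (4.6)] via
`TwistedQuotientIndFunShapiroNatural`); the kernel of `H^q(Γ, M̃_s) → H^q_k(S_L, Ṽ)` is finitely
generated (Noetherian) and each element dies in some `H^q(Γ, M̃_{s'})`
(`exists_intFunIncl_map_eq_zero`, via `TwistedQuotientIndFunDirectedInjective`), so after
enlarging `s` the preimage of `ξ` is an exact eigenclass; its content is bounded by
`PPowerTorsionEigenclass.exists_content_bound`.  This is the passage "`x ⊗ ℚ̄_p` is defined over a
finite extension; `p^t ξ ∈ H^q(X_U, M̃_{E'})`" of [Scholze2015, §V.4, proof of Thm. V.4.1], in a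
form that needs no base-change theorem for cohomology.

## References

* P. Scholze, *On torsion in the cohomology of locally symmetric varieties*, Ann. of Math. 182
  (2015), §V.4, proof of Thm. V.4.1. [Scholze2015]
* K. S. Brown, *Cohomology of Groups*, GTM 87 (1982), VIII (4.6), VIII.4 Ex. 1. [Brown1982CohomologyGroups]
-/

noncomputable section

open CategoryTheory Literature.Algebra.Homology Literature.Algebra.Module
open scoped Classical

universe u

namespace Literature.NumberTheory.Automorphic

namespace TwistedQuotient

open IntegralEigenclass

variable {k K : Type u} [CommRing k] [CommRing K] [Algebra k K] {Γ 𝒢 : Type u} [Group Γ] [Group 𝒢]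
  (ι : Γ →* 𝒢) (L : Subgroup 𝒢) {V : Type u} [AddCommGroup V] [Module K V] [Module k V]
  [IsScalarTower k K V] (π : Representation K 𝒢 V) (M : Submodule k V)
  (hM : ∀ l ∈ L, ∀ m ∈ M, resScalars k π l m ∈ M)

/-! ### `Hⁿ` of a morphism, with the objects explicit -/

section CohMap

variable {A B C : Rep k Γ}

/-- `H^q(f)` as a `k`-linear map (the objects of `Rep` being explicit arguments of
`groupCohomology.map`, for unification). [folklore] -/
abbrev cohMapQ (f : A ⟶ B) (q : ℕ) : groupCohomology A q →ₗ[k] groupCohomology B q :=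
  (groupCohomology.map (MonoidHom.id Γ) (A := A) (B := B) f q).hom

/-- Functoriality. [folklore] -/
theorem cohMapQ_comp (f : A ⟶ B) (g : B ⟶ C) (q : ℕ) (x : groupCohomology A q) :
    cohMapQ (f ≫ g) q x = cohMapQ g q (cohMapQ f q x) := by
  rw [cohMapQ, groupCohomology.map_id_comp, ModuleCat.hom_comp, LinearMap.comp_apply]

/-- `H^q(e⁻¹) ∘ H^q(e) = id`. [folklore] -/
theorem cohMapQ_inv_hom (e : A ≅ B) (q : ℕ) (x : groupCohomology A q) :
    cohMapQ e.inv q (cohMapQ e.hom q x) = x :=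
  groupCohomology_map_inv_map_hom_apply e q x

/-- `H^q(e) ∘ H^q(e⁻¹) = id`. [folklore] -/
theorem cohMapQ_hom_inv (e : A ≅ B) (q : ℕ) (y : groupCohomology B q) :
    cohMapQ e.hom q (cohMapQ e.inv q y) = y :=
  groupCohomology_map_inv_map_hom_apply e.symm q y

/-- `H^q(e)` is injective for an isomorphism `e`. [folklore] -/
theorem cohMapQ_injective_of_iso (e : A ≅ B) (q : ℕ) : Function.Injective (cohMapQ e.hom q) :=
  groupCohomology_map_hom_injective_of_iso e q

end CohMap

/-! ### The directed system of scaled lattices -/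

/-- The lattice representation on `M_s`. [folklore] -/
abbrev scaledRep (s : Finset K) : Representation k L (scaledLattice M s) :=
  latticeRep L (resScalars k π) (scaledLattice M s) (scaledLattice_stable M π L hM s)

/-- The lattice representation on `V = ⊤`. [folklore] -/
abbrev topRep : Representation k L (⊤ : Submodule k V) :=
  latticeRep L (resScalars k π) ⊤ (top_stable L (resScalars k π))

/-- `M_s ↪ ⊤`. [folklore] -/
abbrev scaledToTop (s : Finset K) : (scaledRep L π M hM s).IntertwiningMap (topRep L π) :=
  latticeIncl L (resScalars k π) (le_top : scaledLattice M s ≤ ⊤)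
    (scaledLattice_stable M π L hM s) (top_stable L (resScalars k π))

/-- `M_s ↪ M_{s'}` for `s ≤ s'`. [folklore] -/
abbrev scaledTransition {s s' : Finset K} (h : s ≤ s') :
    (scaledRep L π M hM s).IntertwiningMap (scaledRep L π M hM s') :=
  latticeIncl L (resScalars k π) (scaledLattice_mono M h)
    (scaledLattice_stable M π L hM s) (scaledLattice_stable M π L hM s')

/-- The transitions are compatible with the maps to `⊤` (proved through `coe_latticeIncl_apply`,
NOT by `rfl`: a bare `rfl` makes the kernel compare `scaledLattice M s` with `scaledLattice M s'`).
[folklore] -/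
theorem scaledToTop_scaledTransition {s s' : Finset K} (h : s ≤ s') (v : scaledLattice M s) :
    scaledToTop L π M hM s' (scaledTransition L π M hM h v) = scaledToTop L π M hM s v :=
  Subtype.ext (by rw [coe_latticeIncl_apply, coe_latticeIncl_apply, coe_latticeIncl_apply])

/-- The scaled lattices cover `⊤` (same remark). [folklore] -/
theorem exists_scaledToTop_eq (hspan : Submodule.span K (M : Set V) = ⊤) (v : (⊤ : Submodule k V)) :
    ∃ (s : Finset K) (w : scaledLattice M s), scaledToTop L π M hM s w = v := by
  obtain ⟨s, hs⟩ := exists_mem_scaledLattice M hspan (v : V)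
  exact ⟨s, ⟨(v : V), hs⟩, Subtype.ext (coe_latticeIncl_apply _ _ _ _ _ _)⟩

/-! ### Every class of `H^q_k(S_L, Ṽ)` comes from some `H^q(Γ, M̃_s)` -/

variable (s₀ : Finset 𝒢)
  (hdisj : ∀ x ∈ s₀, ∀ y ∈ s₀, (∃ γ : Γ, ι γ • (x : 𝒢 ⧸ L) = (y : 𝒢 ⧸ L)) → x = y)
  (hcov : ∀ g : 𝒢, ∃ x ∈ s₀, ∃ γ : Γ, ι γ • (x : 𝒢 ⧸ L) = (g : 𝒢 ⧸ L))
  (hFP : ∀ x ∈ s₀, ∃ Px : ProjectiveResolution (Rep.trivial k (orbitStabilizer ι L (x : 𝒢 ⧸ L)) k),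
    ∀ i, ∃ m : ℕ, Nonempty (Px.complex.X i ≅ Rep.free k (orbitStabilizer ι L (x : 𝒢 ⧸ L)) (Fin m)))

/-- `intFunι_{M_s} = intFunIncl ≫ intFunTopIso.hom`. [folklore] -/
theorem intFunι_eq_intFunIncl_comp (s : Finset K) :
    intFunι ι L (resScalars k π) (scaledLattice M s) =
      intFunIncl ι L (resScalars k π) (le_top : scaledLattice M s ≤ ⊤) ≫
        (intFunTopIso ι L (resScalars k π)).hom := by
  rw [intFunTopIso_hom, intFunIncl_comp_intFunι]

/-- The comparison square: `(intFunIso M_s)⁻¹ ≫ intFunι = indFunMap ≫ (intFunIso ⊤)⁻¹ ≫ intFunTopIso`.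
[folklore] -/
theorem intFunIso_inv_comp_intFunι (s : Finset K) :
    (intFunIso ι L (resScalars k π) (scaledLattice M s) (scaledLattice_stable M π L hM s)).inv ≫
        intFunι ι L (resScalars k π) (scaledLattice M s) =
      indFunMap ι L _ _ (scaledToTop L π M hM s) ≫
        (intFunIso ι L (resScalars k π) ⊤ (top_stable L (resScalars k π))).inv ≫
          (intFunTopIso ι L (resScalars k π)).hom := by
  rw [Iso.inv_comp_eq, intFunι_eq_intFunIncl_comp, intFunIso_hom_comp_indFunMap_assoc,
    Iso.hom_inv_id_assoc]

include hM hdisj hcov hFP in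
/-- **Every class of `H^q_k(S_L, Ṽ)` is the image of a class of some `H^q(Γ, M̃_s)`** (`M` spans
`V` over `K`). [cite: Scholze2015, §V.4 (proof of Thm. V.4.1)] [cite: Brown1982CohomologyGroups, VIII (4.6)] -/
theorem exists_intFun_map_eq (hspan : Submodule.span K (M : Set V) = ⊤) (q : ℕ)
    (ξ : groupCohomology (coeffRep ι L ((resScalars k π).comp ι)) q) :
    ∃ (s : Finset K) (y : groupCohomology (intFun ι L (resScalars k π) (scaledLattice M s)) q),
      cohMapQ (intFunι ι L (resScalars k π) (scaledLattice M s)) q y = ξ := by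
  let isoTop := intFunIso ι L (resScalars k π) ⊤ (top_stable L (resScalars k π))
  let eTop := intFunTopIso ι L (resScalars k π)
  let z : groupCohomology (indFun ι L (topRep L π)) q := cohMapQ isoTop.hom q (cohMapQ eTop.inv q ξ)
  obtain ⟨s, y₁, hy₁⟩ := exists_map_indFunMap_eq_of_directed ι L (topRep L π)
    (scaledRep L π M hM) (scaledToTop L π M hM)
    (fun s => latticeIncl_injective L (resScalars k π) (le_top : scaledLattice M s ≤ ⊤)
      (scaledLattice_stable M π L hM s) (top_stable L (resScalars k π)))
    (fun _ _ h => scaledTransition L π M hM h) (fun _ _ h v => scaledToTop_scaledTransition L π M hM h v)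
    (exists_scaledToTop_eq L π M hM hspan) s₀ hdisj hcov hFP q z
  let isoS := intFunIso ι L (resScalars k π) (scaledLattice M s) (scaledLattice_stable M π L hM s)
  refine ⟨s, cohMapQ isoS.inv q y₁, ?_⟩
  have hy₁' : cohMapQ (indFunMap ι L _ _ (scaledToTop L π M hM s)) q y₁ = z := hy₁
  rw [← cohMapQ_comp, intFunIso_inv_comp_intFunι ι L π M hM s, cohMapQ_comp, cohMapQ_comp, hy₁']
  show cohMapQ eTop.hom q (cohMapQ isoTop.inv q (cohMapQ isoTop.hom q (cohMapQ eTop.inv q ξ))) = ξ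
  rw [cohMapQ_inv_hom, cohMapQ_hom_inv]

include hM hdisj hcov hFP in
/-- **A class of `H^q(Γ, M̃_s)` dying in `H^q_k(S_L, Ṽ)` dies in some `H^q(Γ, M̃_{s'})`, `s' ≥ s`.**
[cite: Scholze2015, §V.4 (proof of Thm. V.4.1)] [cite: Brown1982CohomologyGroups, VIII (4.6)] -/
theorem exists_intFunIncl_map_eq_zero (hspan : Submodule.span K (M : Set V) = ⊤) (q : ℕ)
    (s : Finset K) (y : groupCohomology (intFun ι L (resScalars k π) (scaledLattice M s)) q)
    (hy : cohMapQ (intFunι ι L (resScalars k π) (scaledLattice M s)) q y = 0) :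
    ∃ (s' : Finset K) (h : s ≤ s'),
      cohMapQ (intFunIncl ι L (resScalars k π) (scaledLattice_mono M h)) q y = 0 := by
  let isoTop := intFunIso ι L (resScalars k π) ⊤ (top_stable L (resScalars k π))
  let eTop := intFunTopIso ι L (resScalars k π)
  let isoS := intFunIso ι L (resScalars k π) (scaledLattice M s) (scaledLattice_stable M π L hM s)
  let y₁ : groupCohomology (indFun ι L (scaledRep L π M hM s)) q := cohMapQ isoS.hom q y
  -- `y₁ ↦ 0` in `H^q(indFun ⊤)`
  have hsq : isoS.hom ≫ indFunMap ι L _ _ (scaledToTop L π M hM s) =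
      intFunι ι L (resScalars k π) (scaledLattice M s) ≫ eTop.inv ≫ isoTop.hom := by
    rw [intFunIso_hom_comp_indFunMap, intFunι_eq_intFunIncl_comp, Category.assoc,
      Iso.hom_inv_id_assoc]
  have hy₁ : groupCohomology.map (MonoidHom.id Γ) (indFunMap ι L _ _ (scaledToTop L π M hM s)) q y₁ = 0 := by
    show cohMapQ (indFunMap ι L _ _ (scaledToTop L π M hM s)) q (cohMapQ isoS.hom q y) = 0
    rw [← cohMapQ_comp, hsq, cohMapQ_comp, hy, map_zero]
  obtain ⟨s', h, hs'⟩ := exists_map_indFunMap_eq_zero_of_directed ι L (topRep L π)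
    (scaledRep L π M hM) (scaledToTop L π M hM)
    (fun s => latticeIncl_injective L (resScalars k π) (le_top : scaledLattice M s ≤ ⊤)
      (scaledLattice_stable M π L hM s) (top_stable L (resScalars k π)))
    (fun _ _ h => scaledTransition L π M hM h) (fun _ _ h v => scaledToTop_scaledTransition L π M hM h v)
    (exists_scaledToTop_eq L π M hM hspan) s₀ hdisj hcov hFP q s y₁ hy₁
  refine ⟨s', h, ?_⟩
  -- transport back along `intFunIso_{M_{s'}}`
  let isoS' := intFunIso ι L (resScalars k π) (scaledLattice M s') (scaledLattice_stable M π L hM s')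
  have hsq' : isoS.hom ≫ indFunMap ι L _ _ (scaledTransition L π M hM h) =
      intFunIncl ι L (resScalars k π) (scaledLattice_mono M h) ≫ isoS'.hom :=
    intFunIso_hom_comp_indFunMap ι L (resScalars k π) (scaledLattice_mono M h)
      (scaledLattice_stable M π L hM s) (scaledLattice_stable M π L hM s')
  have hs'' : cohMapQ (indFunMap ι L _ _ (scaledTransition L π M hM h)) q y₁ = 0 := hs'
  apply cohMapQ_injective_of_iso isoS' q
  rw [map_zero, ← cohMapQ_comp, ← hsq', cohMapQ_comp]
  exact hs''

/-! ### Finiteness of `H^q(Γ, M̃_s)` -/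

include hM hdisj hcov hFP in
/-- `H^q(Γ, M̃_s)` is a finitely generated `k`-module (`k` Noetherian, `M` finitely generated,
stabilisers of type `FP_∞`). [cite: Brown1982CohomologyGroups, VIII.4 Ex. 1] -/
theorem moduleFinite_cohomology_intFun_scaledLattice [IsNoetherianRing k] (hMfg : M.FG) (q : ℕ)
    (s : Finset K) :
    Module.Finite k (groupCohomology (intFun ι L (resScalars k π) (scaledLattice M s)) q) := by
  haveI : Module.Finite k (scaledLattice M s) := Module.Finite.iff_fg.2 (scaledLattice_fg M hMfg s)
  haveI : Module.Finite k (groupCohomology (indFun ι L (scaledRep L π M hM s)) q) :=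
    moduleFinite_cohomology_indFun_of_orbits ι L (scaledRep L π M hM s) s₀ hdisj hcov q
      fun x hx => by
        obtain ⟨Px, hPx⟩ := hFP x hx
        exact moduleFinite_groupCohomology_of_finiteType_resolution Px hPx
          (indStabilizerRep ι L (scaledRep L π M hM s) x) q
  let e := intFunIso ι L (resScalars k π) (scaledLattice M s) (scaledLattice_stable M π L hM s)
  exact Module.Finite.of_surjective (cohMapQ e.inv q) fun x => ⟨cohMapQ e.hom q x, cohMapQ_inv_hom e q x⟩

/-! ### The main theorem -/

include hM hdisj hcov hFP in
/-- **A rational eigenclass comes from an exact integral eigenclass of bounded content on a free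
lattice.**  See the module docstring. [cite: Scholze2015, §V.4 (proof of Thm. V.4.1)] -/
theorem exists_intFun_exact_eigenclass [IsDomain k] [IsPrincipalIdealRing k] [IsLocalRing k]
    [Module.IsTorsionFree k V] (hMfg : M.FG) (hspan : Submodule.span K (M : Set V) = ⊤)
    {p : ℕ} (hp : (p : k) ∈ IsLocalRing.maximalIdeal k)
    {J : Type*} (δ : J → 𝒢) (hδ : ∀ j, resScalars k π (δ j) = 1) (χ : J → k)
    (Lev : ℕ → Subgroup 𝒢)
    (hcong : ∀ t' : ℕ, ∃ r : ℕ, ∀ l ∈ L, l ∈ Lev r → ∀ m ∈ M,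
      π l m - m ∈ (Ideal.span {((p ^ t' : ℕ) : k)} : Ideal k) • M)
    {q : ℕ} (ξ : groupCohomology (coeffRep ι L ((resScalars k π).comp ι)) q)
    (hξ : ∀ m : ℕ, (p : k) ^ m • ξ ≠ 0)
    (heig : ∀ j, heckeEnd ι L ((resScalars k π).comp ι) (δ j) q ξ = χ j • ξ) :
    ∃ (M' : Submodule k V) (hM' : ∀ l ∈ L, ∀ m ∈ M', resScalars k π l m ∈ M') (d : ℕ)
      (_ : M' ≃ₗ[k] (Fin d → k))
      (c : groupCohomology (intFun ι L (resScalars k π) M') q) (m₀ : ℕ),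
      M ≤ M' ∧
      (∀ t' : ℕ, ∃ r : ℕ, ModTrivialOn (resScalars k π) M' hM' (p ^ t') (Lev r)) ∧
      (∀ j, (groupCohomology.map (MonoidHom.id Γ) (A := intFun ι L (resScalars k π) M')
        (B := intFun ι L (resScalars k π) M')
        (heckeIntHom ι L (resScalars k π) M' hM' (rep_mem_of_eq_one _ M' (hδ j))) q).hom c = χ j • c) ∧
      cohMapQ (intFunι ι L (resScalars k π) M') q c = ξ ∧
      ∀ (u : ℕ) (y : groupCohomology (intFun ι L (resScalars k π) M') q),
        (p : k) ^ u • c ≠ (p : k) ^ (u + m₀) • y := by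
  haveI : IsNoetherianRing k := inferInstance
  -- Step 1: `ξ` comes from some `M̃_s`
  obtain ⟨s, y, hy⟩ := exists_intFun_map_eq ι L π M hM s₀ hdisj hcov hFP hspan q ξ
  -- notation: cohomology of `M̃_t`, the maps to `H^q_k(S_L, Ṽ)`, the inclusions, the Hecke operators
  let H : Finset K → Type u := fun t => groupCohomology (intFun ι L (resScalars k π) (scaledLattice M t)) q
  let f : ∀ t : Finset K, H t →ₗ[k] groupCohomology (coeffRep ι L ((resScalars k π).comp ι)) q :=
    fun t => cohMapQ (intFunι ι L (resScalars k π) (scaledLattice M t)) q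
  let incl : ∀ {t t' : Finset K}, t ≤ t' → (H t →ₗ[k] H t') := fun h =>
    cohMapQ (intFunIncl ι L (resScalars k π) (scaledLattice_mono M h)) q
  let T : ∀ (t : Finset K) (_ : J), H t →ₗ[k] H t := fun t j =>
    cohMapQ (heckeIntHom ι L (resScalars k π) (scaledLattice M t) (scaledLattice_stable M π L hM t)
      (rep_mem_of_eq_one _ _ (hδ j))) q
  have hf_incl : ∀ {t t' : Finset K} (h : t ≤ t') (x : H t), f t' (incl h x) = f t x := by
    intro t t' h x
    show cohMapQ _ q (cohMapQ _ q x) = cohMapQ _ q x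
    rw [← cohMapQ_comp, intFunIncl_comp_intFunι]
  have hTf : ∀ (t : Finset K) (j : J) (x : H t),
      f t (T t j x) = heckeEnd ι L ((resScalars k π).comp ι) (δ j) q (f t x) := by
    intro t j x
    show cohMapQ _ q (cohMapQ _ q x) = cohMapQ _ q (cohMapQ _ q x)
    rw [← cohMapQ_comp, heckeIntHom_comp_intFunι, cohMapQ_comp]
  have hTincl : ∀ {t t' : Finset K} (h : t ≤ t') (j : J) (x : H t),
      incl h (T t j x) = T t' j (incl h x) := by
    intro t t' h j x
    show cohMapQ _ q (cohMapQ _ q x) = cohMapQ _ q (cohMapQ _ q x)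
    rw [← cohMapQ_comp, heckeIntHom_comp_intFunIncl, cohMapQ_comp]
  haveI : ∀ t, Module.Finite k (H t) := fun t =>
    moduleFinite_cohomology_intFun_scaledLattice ι L π M hM s₀ hdisj hcov hFP hMfg q t
  -- Step 2: a bigger `S ⊇ s` and a comparison map `g : H s → H S` killing `ker (f s)`
  have hker : ∃ (S : Finset K) (g : H s →ₗ[k] H S), M ≤ scaledLattice M S ∧
      (∀ x, f S (g x) = f s x) ∧ (∀ j x, g (T s j x) = T S j (g x)) ∧ ∀ x, f s x = 0 → g x = 0 := by
    obtain ⟨G, hG⟩ := (IsNoetherian.noetherian (LinearMap.ker (f s)) : (LinearMap.ker (f s)).FG)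
    -- kill the generators one at a time, enlarging the lattice
    have step : ∀ G' : Finset (H s), G' ⊆ G → ∃ (S : Finset K) (g : H s →ₗ[k] H S),
        M ≤ scaledLattice M S ∧ (∀ x, f S (g x) = f s x) ∧ (∀ j x, g (T s j x) = T S j (g x)) ∧
        ∀ x ∈ G', g x = 0 := by
      intro G'
      induction G' using Finset.induction_on with
      | empty =>
        intro
        exact ⟨s, LinearMap.id, le_scaledLattice M s, fun x => rfl, fun j x => rfl,
          fun x hx => absurd hx (Finset.notMem_empty x)⟩
      | insert a G' ha ih =>
        intro hsub
        obtain ⟨S, g, hMS, hgf, hgT, hgG⟩ := ih ((Finset.subset_insert a G').trans hsub)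
        have ha0 : f S (g a) = 0 := by
          rw [hgf]
          have haG : a ∈ Submodule.span k (G : Set (H s)) :=
            Submodule.subset_span (hsub (Finset.mem_insert_self a G'))
          rw [hG] at haG
          exact haG
        obtain ⟨S', hSS', hkill⟩ :=
          exists_intFunIncl_map_eq_zero ι L π M hM s₀ hdisj hcov hFP hspan q S (g a) ha0
        refine ⟨S', incl hSS' ∘ₗ g, hMS.trans (scaledLattice_mono M hSS'), fun x => ?_, fun j x => ?_,
          fun x hx => ?_⟩
        · rw [LinearMap.comp_apply, hf_incl hSS', hgf]
        · rw [LinearMap.comp_apply, LinearMap.comp_apply, hgT, hTincl hSS']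
        · rw [LinearMap.comp_apply]
          rcases Finset.mem_insert.1 hx with rfl | hx
          · exact hkill
          · rw [hgG x hx, map_zero]
    obtain ⟨S, g, hMS, hgf, hgT, hgG⟩ := step G subset_rfl
    refine ⟨S, g, hMS, hgf, hgT, fun x hx => ?_⟩
    have hxspan : x ∈ Submodule.span k (G : Set (H s)) := by rw [hG]; exact hx
    clear hx
    induction hxspan using Submodule.span_induction with
    | mem x hxG => exact hgG x hxG
    | zero => exact map_zero g
    | add x y _ _ hx hy => rw [map_add, hx, hy, add_zero]
    | smul a x _ hx => rw [map_smul, hx, smul_zero]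
  obtain ⟨S, g, hMS, hgf, hgT, hgker⟩ := hker
  -- Step 3: the lattice `M' = M_S` and the class `c = g y`
  let M' := scaledLattice M S
  have hM' := scaledLattice_stable M π L hM S
  let c : H S := g y
  have hfc : f S c = ξ := by rw [hgf]; exact hy
  -- exact eigenclass
  have heigc : ∀ j, T S j c = χ j • c := by
    intro j
    have h0 : f s (T s j y - χ j • y) = 0 := by
      rw [map_sub, map_smul, hTf, hy, heig, sub_self]
    have h1 := hgker _ h0
    rw [map_sub, map_smul, hgT] at h1
    exact sub_eq_zero.1 h1
  -- freeness (`M'` finitely generated and torsion-free over the principal ideal domain `k`)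
  haveI : Module.Finite k M' := Module.Finite.iff_fg.2 (scaledLattice_fg M hMfg S)
  -- content bound
  have hc : ∀ m : ℕ, (p : k) ^ m • c ≠ 0 := fun m h0 =>
    hξ m (by rw [← hfc, ← map_smul, h0, map_zero])
  obtain ⟨m₀, hm₀⟩ := exists_content_bound hp c hc
  -- congruences
  have hmod : ∀ t' : ℕ, ∃ r : ℕ, ModTrivialOn (resScalars k π) M' hM' (p ^ t') (Lev r) := by
    intro t'
    obtain ⟨r, hr⟩ := hcong t'
    exact ⟨r, modTrivialOn_scaledLattice M π L hM (p ^ t') (Lev r)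
      (fun l hl hl' m hm => hr l hl hl' m hm) S⟩
  exact ⟨M', hM', Module.finrank k M', (Module.finBasis k M').equivFun, c, m₀,
    hMS, hmod, heigc, hfc, hm₀⟩

end TwistedQuotient

end Literature.NumberTheory.Automorphic
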